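import Literature.Geometry.Kaehler.ComplexTorusIntegralHodgeLatticeTopMinimalClassValueGroup
import Literature.Geometry.Kaehler.ComplexTorusIntegralHodgeLatticeSignatureClosedForm
import Literature.Geometry.Kaehler.ComplexTorusLefschetzFormPrimitiveLatticeSignature
import HarnessLib

/-!
# The signature of the orthogonal complement of the minimal class:
# `(b⁺, b⁻)(s'·B ∣ γ_p^⊥) = (Σ_{i ≤ p, i even} ρ_pr^{(i)} − 1, Σ_{i ≤ p, i odd} ρ_pr^{(i)})`, `s' = sign(e)·(−1)^q`

Layer `Literature/Geometry/Kaehler`, namespace `Literature.Geometry.Kaehler.ComplexTorus`; lane `lit-hodgefound`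
(Track 2 foundations library), seat p09, generation 49, row g49-#4. THEOREMS ONLY (0 definitions); no named fact, net debt 0.
Companion of g49-#3 (`…TopMinimalClassSplittingDiscriminant`: the discriminant of `γ_p^⊥`) and of g46-#9 (`…PrimitiveSplitting`: the signature of the
orthogonal complement of the PRIMITIVE lattice): here the real invariants of the orthogonal complement `γ_p^⊥` of the minimal class
`γ_p = θ^{∧p}/(p!·d₁⋯d_p)` in the integral Hodge lattice `M = Hdgᵖ(X, ℤ)` of a polarised abelian variety (`2p + q = g = j + 2`, type `(d₁, …, d_g)`,
`B = ⟨·, γ_q ∧ ·⟩_e`, `s' = sign(e)·(−1)^q`, so that `s'·B∣Hdgᵖ` has indices `(Σ_{i ≤ p even} ρ_pr^{(i)}, Σ_{odd} ρ_pr^{(i)})`, g46-#1):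

* §1 **THE MINIMAL CLASS SPANS A POSITIVE LINE: `0 < s'·B(γ_p, γ_p)`** (`IsPolarizationType.orientationSign_mul_neg_one_pow_mul_apply_minimalClass_self_pos`; from
  `sign(e)·(p!d₁⋯d_p)²(q!d₁⋯d_q)·B(γ_p, γ_p) = (−1)^g·g!·d₁⋯d_g`, g48-#5, and `q + g = 2(p + q)` even).
* §2 **THE INDICES OF `γ_p^⊥`: `b⁺(s'·B∣γ_p^⊥) + 1 = Σ_{i ≤ p, i even} ρ_pr^{(i)}`, `b⁻(s'·B∣γ_p^⊥) = Σ_{i ≤ p, i odd} ρ_pr^{(i)}`**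
  (`IsPolarizationType.sigPos_sigNeg_orthogonal_minimalClass`): the orthogonal sum `ℤγ_p ⊕ γ_p^⊥ ⊆ Hdgᵖ(X, ℤ)` has finite index (g48-#5), a finite-index sublattice
  has the same real indices (Serre), the indices add on orthogonal sums, and `(b⁺, b⁻)(ℤγ_p) = (1, 0)` (the tree's
  `sigPos_sigNeg_restrict_orthogonal_span_singleton_of_apply_self_pos`). In particular (`ρ_pr^{(0)} = 1`) `γ_p^⊥` is NEGATIVE DEFINITE for `s'·B` iff
  `ρ_pr^{(i)} = 0` for every even `0 < i ≤ p`, and `p = 1`: **`θ^⊥ = Hdg¹(X, ℤ)_prim` is negative definite for `s'·B₂`, `b⁻ = ρ − 1`** (Hodge index;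
  `IsPolarizationType.sigPos_sigNeg_orthogonal_minimalClass_of_degree_two`, the Hodge-lattice reading of g44-#1).
* §3 data-free existence form.

## References

* [cite: Serre1973, Ch. V §1.3.2 and §1.3.7]
* [cite: MilnorHusemoller1973, Ch. II §2]
* [cite: VoisinHodgeI2002, §6.3.2 Lemma 6.31, Thm. 6.32–6.33 and (6.12) (PDF pp. 128–129); §7.1.2 (PDF p. 134)]
* [cite: Lange2023AbelianVarietiesComplex, §5.4.1 Thm. 5.4.2 and (5.22)–(5.23) (PDF p. 275); §5.2 Thm. 5.2.4 (PDF p. 262); §2.5.3 Cor. 2.5.17 (d) (PDF p. 135); §1.7.2 Lemma 1.7.5]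
* [cite: Kitaoka1993, Ch. 5 Prop. 5.3.3 (proof)]
* [cite: Hartshorne1977, Ch. V Thm. 1.9, Rem. 1.9.1]
-/

noncomputable section

-- `Module ℂ` / `SMulZeroClass ℂ` synthesis on `E [⋀^Fin k]→L[ℝ] ℂ` (as in `ComplexTorusLefschetzDecomposition`)
set_option maxSynthPendingDepth 3

open Module Function Complex
open LinearMap (BilinForm)
open Literature.LinearAlgebra.Alternating
open Literature.Analysis.Complex (IsOfTypeAt typeSubmodule mem_typeSubmodule_iff_isOfTypeAt)

namespace Literature.Geometry.Kaehler.ComplexTorus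

/-! ## §1 The minimal class spans a positive line for `s'·B` -/

section Positive

variable {ι : Type*} [Fintype ι] [DecidableEq ι] {E : Type*} [NormedAddCommGroup E] [NormedSpace ℂ E]
  {Φ : (ι → ℝ) ≃L[ℝ] E} {j n p q : ℕ} {η : E [⋀^Fin 2]→L[ℝ] ℝ} {d : Fin (j + 2) → ℕ}

/-- **`0 < sign(e)·(−1)^q · B(γ_p, γ_p)`**: for the sign `s' = sign(e)·(−1)^q` making `s'·B_{2p}` positive on the even-parity Hodge–Lefschetz pieces (g46-#3), the
minimal class `γ_p = θ^{∧p}/(p!·d₁⋯d_p)` (a class of type `(p, p)` in the top Lefschetz piece `L^p H^{0,0}`) has POSITIVE square: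
`(−1)^q·sign(e)·(p!d₁⋯d_p)²(q!d₁⋯d_q)·B(γ_p, γ_p) = (−1)^{q+g}·g!·d₁⋯d_g = g!·d₁⋯d_g` as `q + g = 2(p + q)`.
[cite: VoisinHodgeI2002, §6.3.2 Thm. 6.32 and (6.12) (PDF pp. 128–129)] [cite: Lange2023AbelianVarietiesComplex, §1.7.2 Lemma 1.7.5; §2.5.3 Cor. 2.5.17 (d) (PDF p. 135)] -/
theorem IsPolarizationType.orientationSign_mul_neg_one_pow_mul_apply_minimalClass_self_pos (hd : IsPolarizationType Φ η d) (hη : IsRiemannForm Φ η)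
    (hp : p ≤ j + 2) (hq : q ≤ j + 2) (hg : p + (q + p) = j + 2)
    {γq : E [⋀^Fin (2 * q)]→L[ℝ] ℂ} (hγq : wedgePow (ofRealForm η) q = ((q.factorial * ∏ i : Fin q, d (Fin.castLE hq i) : ℕ) : ℂ) • γq)
    (e : Fin n ≃ ι) (hn : 2 * p + (2 * q + 2 * p) = n) {B : BilinForm ℤ ↥(integralForms Φ (2 * p))}
    (hB : ∀ x y : ↥(integralForms Φ (2 * p)),
      ((B x y : ℤ) : ℂ) = poincarePairing Φ e hn (x : E [⋀^Fin (2 * p)]→L[ℝ] ℂ) (γq.wedge (y : E [⋀^Fin (2 * p)]→L[ℝ] ℂ)))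
    (γpZ : ↥(integralForms Φ (2 * p)))
    (hγpZ : wedgePow (ofRealForm η) p = ((p.factorial * ∏ i : Fin p, d (Fin.castLE hp i) : ℕ) : ℂ) • (γpZ : E [⋀^Fin (2 * p)]→L[ℝ] ℂ)) :
    0 < orientationSign Φ e * (-1) ^ q * B γpZ γpZ := by
  have h := hd.orientationSign_mul_content_mul_apply_minimalClass_self hη hp hq hg hγpZ hγq e hn hB γpZ rfl
  have hC : (0 : ℤ) < (((p.factorial * ∏ i : Fin p, d (Fin.castLE hp i)) ^ 2 * (q.factorial * ∏ i : Fin q, d (Fin.castLE hq i)) : ℕ) : ℤ) := by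
    exact_mod_cast Nat.mul_pos (Nat.pow_pos (Nat.mul_pos (Nat.factorial_pos p) (Finset.prod_pos fun i _ ↦ hd.pos hη _)))
      (Nat.mul_pos (Nat.factorial_pos q) (Finset.prod_pos fun i _ ↦ hd.pos hη _))
  have hCg : (0 : ℤ) < (((j + 2).factorial * ∏ i, d i : ℕ) : ℤ) := by
    exact_mod_cast Nat.mul_pos (Nat.factorial_pos _) (Finset.prod_pos fun i _ ↦ hd.pos hη i)
  have hqj : ((-1 : ℤ) ^ q) * (-1) ^ (j + 2) = 1 := by
    rw [← pow_add, show q + (j + 2) = 2 * (p + q) by omega, pow_mul, neg_one_sq, one_pow]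
  have key : orientationSign Φ e * (-1) ^ q * B γpZ γpZ *
      ((((p.factorial * ∏ i : Fin p, d (Fin.castLE hp i)) ^ 2 * (q.factorial * ∏ i : Fin q, d (Fin.castLE hq i)) : ℕ) : ℤ)) =
      (((j + 2).factorial * ∏ i, d i : ℕ) : ℤ) := by
    linear_combination ((-1 : ℤ) ^ q) * h + (((j + 2).factorial * ∏ i, d i : ℕ) : ℤ) * hqj
  have hpos : 0 < orientationSign Φ e * (-1) ^ q * B γpZ γpZ *
      ((((p.factorial * ∏ i : Fin p, d (Fin.castLE hp i)) ^ 2 * (q.factorial * ∏ i : Fin q, d (Fin.castLE hq i)) : ℕ) : ℤ)) := by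
    rw [key]
    exact hCg
  exact (mul_pos_iff_of_pos_right hC).1 hpos

end Positive

/-! ## §2 The indices of `γ_p^⊥` -/

section Signature

variable {ι : Type*} [Fintype ι] [DecidableEq ι] {E : Type*} [NormedAddCommGroup E] [NormedSpace ℂ E]
  {Φ : (ι → ℝ) ≃L[ℝ] E} {j n p q : ℕ} {η : E [⋀^Fin 2]→L[ℝ] ℝ} {d : Fin (j + 2) → ℕ}

set_option maxHeartbeats 1600000 in
/-- **THE SIGNATURE OF THE ORTHOGONAL COMPLEMENT OF THE MINIMAL CLASS:
`b⁺(s'·B ∣ γ_p^⊥) + 1 = Σ_{i ≤ p, i even} ρ_pr^{(i)}`, `b⁻(s'·B ∣ γ_p^⊥) = Σ_{i ≤ p, i odd} ρ_pr^{(i)}`** (`s' = sign(e)·(−1)^q`; `γ_p^⊥ = Λ^⊥` for `B∣M`,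
`M = Hdgᵖ(X, ℤ)`, `Λ = ℤγ_p`; `ρ_pr^{(i)} = rk (Hdgⁱ(X, ℤ) ∩ P^{2i})`): the line `ℤγ_p` is positive for `s'·B` (§1), `ℤγ_p ⊕ γ_p^⊥` has finite index in
`Hdgᵖ(X, ℤ)`, so the indices of `γ_p^⊥` are those of `Hdgᵖ(X, ℤ)` (g46-#1) with one positive sign removed.
[cite: Serre1973, Ch. V §1.3.2 and §1.3.7] [cite: MilnorHusemoller1973, Ch. II §2] [cite: VoisinHodgeI2002, §6.3.2 Lemma 6.31, Thm. 6.32–6.33 (PDF pp. 128–129)] [cite: Kitaoka1993, Ch. 5 Prop. 5.3.3 (proof)] -/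
theorem IsPolarizationType.sigPos_sigNeg_orthogonal_minimalClass (hd : IsPolarizationType Φ η d) (hη : IsRiemannForm Φ η)
    (hp : p ≤ j + 2) (hq : q ≤ j + 2) (hg : p + (q + p) = j + 2)
    {γq : E [⋀^Fin (2 * q)]→L[ℝ] ℂ} (hγq : wedgePow (ofRealForm η) q = ((q.factorial * ∏ i : Fin q, d (Fin.castLE hq i) : ℕ) : ℂ) • γq)
    (e : Fin n ≃ ι) (hn : 2 * p + (2 * q + 2 * p) = n) {B : BilinForm ℤ ↥(integralForms Φ (2 * p))}
    (hB : ∀ x y : ↥(integralForms Φ (2 * p)),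
      ((B x y : ℤ) : ℂ) = poincarePairing Φ e hn (x : E [⋀^Fin (2 * p)]→L[ℝ] ℂ) (γq.wedge (y : E [⋀^Fin (2 * p)]→L[ℝ] ℂ)))
    (γM : ↥(AddSubgroup.toIntSubmodule ((integralHodgeClassesIn Φ (2 * p) p).addSubgroupOf (integralForms Φ (2 * p)))))
    (hγM : wedgePow (ofRealForm η) p = ((p.factorial * ∏ i : Fin p, d (Fin.castLE hp i) : ℕ) : ℂ) •
      (((γM : ↥(AddSubgroup.toIntSubmodule ((integralHodgeClassesIn Φ (2 * p) p).addSubgroupOf (integralForms Φ (2 * p))))) :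
        ↥(integralForms Φ (2 * p))) : E [⋀^Fin (2 * p)]→L[ℝ] ℂ))
    (Λ : Submodule ℤ ↥(AddSubgroup.toIntSubmodule ((integralHodgeClassesIn Φ (2 * p) p).addSubgroupOf (integralForms Φ (2 * p)))))
    (hΛ : ∀ x, x ∈ Λ ↔ ∃ a : ℤ, a • γM = x) :
    sigPos ((((orientationSign Φ e * (-1) ^ q) • B).restrict (AddSubgroup.toIntSubmodule ((integralHodgeClassesIn Φ (2 * p) p).addSubgroupOf (integralForms Φ (2 * p))))).restrict
          ((B.restrict (AddSubgroup.toIntSubmodule ((integralHodgeClassesIn Φ (2 * p) p).addSubgroupOf (integralForms Φ (2 * p))))).orthogonal Λ)).toQuadraticMap + 1 =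
        ∑ i ∈ (Finset.range (p + 1)).filter Even, finrank ℤ ↥(integralHodgeClassesIn Φ (2 * i) i ⊓ (primitiveForms η (2 * i)).toAddSubgroup) ∧
      sigNeg ((((orientationSign Φ e * (-1) ^ q) • B).restrict (AddSubgroup.toIntSubmodule ((integralHodgeClassesIn Φ (2 * p) p).addSubgroupOf (integralForms Φ (2 * p))))).restrict
          ((B.restrict (AddSubgroup.toIntSubmodule ((integralHodgeClassesIn Φ (2 * p) p).addSubgroupOf (integralForms Φ (2 * p))))).orthogonal Λ)).toQuadraticMap =
        ∑ i ∈ (Finset.range (p + 1)).filter Odd, finrank ℤ ↥(integralHodgeClassesIn Φ (2 * i) i ⊓ (primitiveForms η (2 * i)).toAddSubgroup) := by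
  classical
  -- `Λ = ℤγ_p`
  obtain rfl : Λ = ℤ ∙ γM := Submodule.ext fun x ↦ by rw [hΛ, Submodule.mem_span_singleton]
  letI : LinearOrder ι := LinearOrder.lift' (Fintype.equivFin ι) (Fintype.equivFin ι).injective
  have sb := Submodule.basisOfPid (intLatMonomialBasis Φ (2 * p))
    (AddSubgroup.toIntSubmodule ((integralHodgeClassesIn Φ (2 * p) p).addSubgroupOf (integralForms Φ (2 * p))))
  haveI : Module.Finite ℤ ↥(AddSubgroup.toIntSubmodule ((integralHodgeClassesIn Φ (2 * p) p).addSubgroupOf (integralForms Φ (2 * p)))) :=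
    Module.Finite.of_basis sb.2
  have hkq : 2 * p + q = j + 2 := by omega
  have hs0 : orientationSign Φ e * (-1) ^ q ≠ 0 := by
    rcases orientationSign_mul_neg_one_pow_eq_or (Φ := Φ) e q with h | h <;> rw [h] <;> norm_num
  -- the indices of `s'·B_M` (g46-#1) and its symmetry
  have h4 := hd.nondegenerate_finrank_sigPos_sigNeg_integralHodgeClassesIn_of_eq_poincarePairing_wedge hη (show p + p = 2 * p by omega) hkq hq hγq e hn hB
  have hpos := h4.2.2.1
  have hneg := h4.2.2.2
  have hsymm : (B.restrict (AddSubgroup.toIntSubmodule ((integralHodgeClassesIn Φ (2 * p) p).addSubgroupOf (integralForms Φ (2 * p))))).IsSymm :=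
    (hd.isSymm_of_eq_poincarePairing_wedge_of_even hη (even_two_mul p) hkq hq hγq e hn hB).restrict _
  have hresM : ((orientationSign Φ e * (-1) ^ q) • B).restrict (AddSubgroup.toIntSubmodule ((integralHodgeClassesIn Φ (2 * p) p).addSubgroupOf (integralForms Φ (2 * p)))) =
      (orientationSign Φ e * (-1) ^ q) • B.restrict (AddSubgroup.toIntSubmodule ((integralHodgeClassesIn Φ (2 * p) p).addSubgroupOf (integralForms Φ (2 * p)))) := rfl
  rw [hresM] at hpos hneg ⊢
  have hsymm_s : ((orientationSign Φ e * (-1) ^ q) • B.restrict (AddSubgroup.toIntSubmodule ((integralHodgeClassesIn Φ (2 * p) p).addSubgroupOf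
      (integralForms Φ (2 * p))))).IsSymm := LinearMap.BilinForm.isSymm_smul_of_isSymm _ _ hsymm
  -- the line is positive
  have hu : 0 < ((orientationSign Φ e * (-1) ^ q) • B.restrict (AddSubgroup.toIntSubmodule ((integralHodgeClassesIn Φ (2 * p) p).addSubgroupOf
      (integralForms Φ (2 * p))))) γM γM := by
    have h := hd.orientationSign_mul_neg_one_pow_mul_apply_minimalClass_self_pos hη hp hq hg hγq e hn hB (γM : ↥(integralForms Φ (2 * p))) hγM
    rw [LinearMap.smul_apply, LinearMap.smul_apply, smul_eq_mul]
    exact h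
  -- split off the positive line (finite index; Serre) and read the indices of `s'·B_M`
  have hadd := sigPos_sigNeg_restrict_orthogonal_span_singleton_of_apply_self_pos _ hsymm_s hu
  rw [orthogonal_smul_eq_of_ne_zero (B.restrict (AddSubgroup.toIntSubmodule ((integralHodgeClassesIn Φ (2 * p) p).addSubgroupOf (integralForms Φ (2 * p))))) hs0 (ℤ ∙ γM),
    hpos, hneg] at hadd
  exact hadd

/-- **`p = 1`: the orthogonal complement `θ^⊥ = γ₁^⊥ = Hdg¹(X, ℤ)_prim` of the polarisation in the Hodge lattice `Hdg¹(X, ℤ) ≅ NS(X)` is NEGATIVE DEFINITE for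
`s'·B₂` and has `b⁻ = ρ_pr^{(1)} = ρ(X) − 1`** (`ρ_pr^{(0)} = 1`: the Hodge index theorem on the lattice, as in g44-#1 for the Néron–Severi model).
[cite: Hartshorne1977, Ch. V Thm. 1.9, Rem. 1.9.1] [cite: Lange2023AbelianVarietiesComplex, §5.2 Thm. 5.2.4 (PDF p. 262)] [cite: VoisinHodgeI2002, §6.3.2 Thm. 6.32–6.33] [cite: Serre1973, Ch. V §1.3.2] -/
theorem IsPolarizationType.sigPos_sigNeg_orthogonal_minimalClass_of_degree_two (hd : IsPolarizationType Φ η d) (hη : IsRiemannForm Φ η)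
    (hp : 1 ≤ j + 2) (hq : q ≤ j + 2) (hg : 1 + (q + 1) = j + 2)
    {γq : E [⋀^Fin (2 * q)]→L[ℝ] ℂ} (hγq : wedgePow (ofRealForm η) q = ((q.factorial * ∏ i : Fin q, d (Fin.castLE hq i) : ℕ) : ℂ) • γq)
    (e : Fin n ≃ ι) (hn : 2 * 1 + (2 * q + 2 * 1) = n) {B : BilinForm ℤ ↥(integralForms Φ (2 * 1))}
    (hB : ∀ x y : ↥(integralForms Φ (2 * 1)),
      ((B x y : ℤ) : ℂ) = poincarePairing Φ e hn (x : E [⋀^Fin (2 * 1)]→L[ℝ] ℂ) (γq.wedge (y : E [⋀^Fin (2 * 1)]→L[ℝ] ℂ)))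
    (γM : ↥(AddSubgroup.toIntSubmodule ((integralHodgeClassesIn Φ (2 * 1) 1).addSubgroupOf (integralForms Φ (2 * 1)))))
    (hγM : wedgePow (ofRealForm η) 1 = ((Nat.factorial 1 * ∏ i : Fin 1, d (Fin.castLE hp i) : ℕ) : ℂ) •
      (((γM : ↥(AddSubgroup.toIntSubmodule ((integralHodgeClassesIn Φ (2 * 1) 1).addSubgroupOf (integralForms Φ (2 * 1))))) :
        ↥(integralForms Φ (2 * 1))) : E [⋀^Fin (2 * 1)]→L[ℝ] ℂ))
    (Λ : Submodule ℤ ↥(AddSubgroup.toIntSubmodule ((integralHodgeClassesIn Φ (2 * 1) 1).addSubgroupOf (integralForms Φ (2 * 1)))))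
    (hΛ : ∀ x, x ∈ Λ ↔ ∃ a : ℤ, a • γM = x) :
    sigPos ((((orientationSign Φ e * (-1) ^ q) • B).restrict (AddSubgroup.toIntSubmodule ((integralHodgeClassesIn Φ (2 * 1) 1).addSubgroupOf (integralForms Φ (2 * 1))))).restrict
          ((B.restrict (AddSubgroup.toIntSubmodule ((integralHodgeClassesIn Φ (2 * 1) 1).addSubgroupOf (integralForms Φ (2 * 1))))).orthogonal Λ)).toQuadraticMap = 0 ∧
      sigNeg ((((orientationSign Φ e * (-1) ^ q) • B).restrict (AddSubgroup.toIntSubmodule ((integralHodgeClassesIn Φ (2 * 1) 1).addSubgroupOf (integralForms Φ (2 * 1))))).restrict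
          ((B.restrict (AddSubgroup.toIntSubmodule ((integralHodgeClassesIn Φ (2 * 1) 1).addSubgroupOf (integralForms Φ (2 * 1))))).orthogonal Λ)).toQuadraticMap =
        finrank ℤ ↥(integralHodgeClassesIn Φ (2 * 1) 1 ⊓ (primitiveForms η (2 * 1)).toAddSubgroup) := by
  have h := hd.sigPos_sigNeg_orthogonal_minimalClass hη hp hq hg hγq e hn hB γM hγM Λ hΛ
  have hse : ∑ i ∈ (Finset.range (1 + 1)).filter Even, finrank ℤ ↥(integralHodgeClassesIn Φ (2 * i) i ⊓ (primitiveForms η (2 * i)).toAddSubgroup) =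
      finrank ℤ ↥(integralHodgeClassesIn Φ (2 * 0) 0 ⊓ (primitiveForms η (2 * 0)).toAddSubgroup) := by
    rw [show (Finset.range (1 + 1)).filter Even = {0} by decide, Finset.sum_singleton]
  have hso : ∑ i ∈ (Finset.range (1 + 1)).filter Odd, finrank ℤ ↥(integralHodgeClassesIn Φ (2 * i) i ⊓ (primitiveForms η (2 * i)).toAddSubgroup) =
      finrank ℤ ↥(integralHodgeClassesIn Φ (2 * 1) 1 ⊓ (primitiveForms η (2 * 1)).toAddSubgroup) := by
    rw [show (Finset.range (1 + 1)).filter Odd = {1} by decide, Finset.sum_singleton]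
  have h0 : finrank ℤ ↥(integralHodgeClassesIn Φ (2 * 0) 0 ⊓ (primitiveForms η (2 * 0)).toAddSubgroup) = 1 :=
    finrank_integralHodgeClassesIn_inf_primitiveForms_zero (Φ := Φ) (η := η)
  have h1 := h.1.trans (hse.trans h0)
  exact ⟨by omega, h.2.trans hso⟩

end Signature

/-! ## §3 Data-free form -/

section DataFree

variable {ι : Type*} [Fintype ι] [DecidableEq ι] {E : Type*} [NormedAddCommGroup E] [NormedSpace ℂ E]
  {Φ : (ι → ℝ) ≃L[ℝ] E} {j p q : ℕ} {η : E [⋀^Fin 2]→L[ℝ] ℝ} {d : Fin (j + 2) → ℕ}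

/-- **THE SIGNATURE OF `γ_p^⊥`, DATA-FREE** (`2p + q = g`): there are an orientation `e`, the minimal class `γ_p ∈ M = Hdgᵖ(X, ℤ)` and a symmetric integral Lefschetz
form `B = ⟨·, γ_q ∧ ·⟩_e` on `H^{2p}(X, ℤ)` with `0 < s'·B(γ_p, γ_p)` (`s' = sign(e)·(−1)^q`) such that for the line `Λ = ℤγ_p` and its `B∣M`-orthogonal `Λ^⊥`:
`b⁺(s'·B∣Λ^⊥) + 1 = Σ_{i ≤ p, i even} ρ_pr^{(i)}` and `b⁻(s'·B∣Λ^⊥) = Σ_{i ≤ p, i odd} ρ_pr^{(i)}`.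
[cite: Serre1973, Ch. V §1.3.2 and §1.3.7] [cite: VoisinHodgeI2002, §6.3.2 Lemma 6.31, Thm. 6.32–6.33 (PDF pp. 128–129)] [cite: Lange2023AbelianVarietiesComplex, §5.4.1 Thm. 5.4.2 and (5.22)–(5.23) (PDF p. 275); §2.5.3 Cor. 2.5.17 (d)] -/
theorem IsPolarizationType.exists_sigPos_sigNeg_orthogonal_minimalClass (hd : IsPolarizationType Φ η d) (hη : IsRiemannForm Φ η) (hp : p ≤ j + 2)
    (hq : q ≤ j + 2) (hkq : 2 * p + q = j + 2) :
    ∃ (e : Fin (2 * p + (2 * q + 2 * p)) ≃ ι) (γM : ↥(AddSubgroup.toIntSubmodule ((integralHodgeClassesIn Φ (2 * p) p).addSubgroupOf (integralForms Φ (2 * p))))) (B : BilinForm ℤ ↥(integralForms Φ (2 * p))),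
      wedgePow (ofRealForm η) p = ((p.factorial * ∏ i : Fin p, d (Fin.castLE hp i) : ℕ) : ℂ) •
        (((γM : ↥(AddSubgroup.toIntSubmodule ((integralHodgeClassesIn Φ (2 * p) p).addSubgroupOf (integralForms Φ (2 * p))))) : ↥(integralForms Φ (2 * p))) : E [⋀^Fin (2 * p)]→L[ℝ] ℂ) ∧ B.IsSymm ∧
      0 < orientationSign Φ e * (-1) ^ q * B (γM : ↥(integralForms Φ (2 * p))) (γM : ↥(integralForms Φ (2 * p))) ∧
      ∀ (Λ : Submodule ℤ ↥(AddSubgroup.toIntSubmodule ((integralHodgeClassesIn Φ (2 * p) p).addSubgroupOf (integralForms Φ (2 * p))))), (∀ x, x ∈ Λ ↔ ∃ a : ℤ, a • γM = x) →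
        sigPos ((((orientationSign Φ e * (-1) ^ q) • B).restrict (AddSubgroup.toIntSubmodule ((integralHodgeClassesIn Φ (2 * p) p).addSubgroupOf (integralForms Φ (2 * p))))).restrict ((B.restrict (AddSubgroup.toIntSubmodule ((integralHodgeClassesIn Φ (2 * p) p).addSubgroupOf (integralForms Φ (2 * p))))).orthogonal Λ)).toQuadraticMap + 1 =
            ∑ i ∈ (Finset.range (p + 1)).filter Even, finrank ℤ ↥(integralHodgeClassesIn Φ (2 * i) i ⊓ (primitiveForms η (2 * i)).toAddSubgroup) ∧
          sigNeg ((((orientationSign Φ e * (-1) ^ q) • B).restrict (AddSubgroup.toIntSubmodule ((integralHodgeClassesIn Φ (2 * p) p).addSubgroupOf (integralForms Φ (2 * p))))).restrict ((B.restrict (AddSubgroup.toIntSubmodule ((integralHodgeClassesIn Φ (2 * p) p).addSubgroupOf (integralForms Φ (2 * p))))).orthogonal Λ)).toQuadraticMap =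
            ∑ i ∈ (Finset.range (p + 1)).filter Odd, finrank ℤ ↥(integralHodgeClassesIn Φ (2 * i) i ⊓ (primitiveForms η (2 * i)).toAddSubgroup) := by
  refine (hd.exists_minimalClass_mem_toIntSubmodule hη hp).elim fun γM hγM ↦ ?_
  refine (hd.exists_mem_integralForms_wedgePow_eq_content_smul hq).elim fun γq hγq' ↦ ?_
  have hγqZ := hγq'.1
  have hγq := hγq'.2
  have hcard : Fintype.card ι = 2 * p + (2 * q + 2 * p) := by rw [hd.card_eq]; omega
  let e : Fin (2 * p + (2 * q + 2 * p)) ≃ ι := (Fintype.equivFinOfCardEq hcard).symm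
  refine (exists_bilinForm_eq_poincarePairing_wedge_of_degree Φ hγqZ e rfl).elim fun B hB ↦ ?_
  have hg : p + (q + p) = j + 2 := by omega
  refine ⟨e, γM, B, hγM, hd.isSymm_of_eq_poincarePairing_wedge_of_even hη (even_two_mul p) hkq hq hγq e rfl hB,
    hd.orientationSign_mul_neg_one_pow_mul_apply_minimalClass_self_pos hη hp hq hg hγq e rfl hB (γM : ↥(integralForms Φ (2 * p))) hγM, fun Λ hΛ ↦ ?_⟩
  exact hd.sigPos_sigNeg_orthogonal_minimalClass hη hp hq hg hγq e rfl hB γM hγM Λ hΛ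

end DataFree

end Literature.Geometry.Kaehler.ComplexTorus

end
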